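import Summits.QuantumFields.YangMills.Theorems.ColdStartUniversalityShenZhuZhuTorusRectangleSU2
import HarnessLib

/-!
# Variance of Lipschitz cylinder observables and of WILSON LOOPS on every torus `(ℤ/L)³`, uniformly in the volume, for `SU(2)` lattice
# Yang–Mills at strong coupling (`|β'| < 1/12`): `Var_{L,β'}(W_C) ≤ Σ_e mult_C(e)²/(2(1 − 12|β'|))`, `Var_{L,β'}(W_{R×T}) ≤ (R+T)/(1 − 12|β'|)`

Seat `ym-line-csu-p1` (g38), route `ColdStartUniversality` of `Summits/QuantumFields/YangMills`, helper file G10 — the Poincaré companion of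
G7/G9 on the torus: the seat's gradient-form Poincaré inequality on every torus (`torus_variance_le_sum_linkGradSq_of_hessBound`, Shen–Zhu–Zhu
Cor. 4.4 (4.11) verbatim) with the pointwise bound `|∇_e F|² ≤ ℓ_e²` for link-Lipschitz `f` (`linkGradSq_le_sq_of_linkLipschitz`), then the
Wilson-loop dictionary of G5/G8/G9.

* `torus_cylinder_variance_le_of_hessBound` / `torus_cylinder_variance_su2_uniform` — `∫(F − ⟨F⟩)² dμ_{L,β'} ≤ Σ_e ℓ_e²/(1 − K₀/2)`, resp.
  `≤ Σ_e ℓ_e²/(1 − 12|β'|)` for `|β'| < 1/12`, for `F = f((U_e)_(e∈Λ)) ∘ torusLift`, every `L`.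
* ★★ `torus_wilsonLoop_variance_su2_uniform` (+ `_of_isTrail`) — `Var_{L,β'}(W_C) ≤ Σ_e mult_C(e)²/(2(1 − 12|β'|))` (`≤ |C|/(2(1 − 12|β'|))` for
  closed trails) for every closed walk `C` whose links stay distinct on the torus.
* ★★★ `torus_wilsonLoop_rect_variance_su2` — in the tree's finite-volume vocabulary: for `wilsonMeasure (fundamentalRep (Fin 2)) β'` on `(ℤ/L)³`,
  `|β'| < 1/12`, every torus base point, `i ≠ j`, `1 ≤ R, T < L`:  `Var[wilsonLoop (fundamentalRep (Fin 2)) x i j R T] ≤ (R + T)/(1 − 12|β'|)` —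
  PERIMETER growth of Wilson-loop fluctuations, the same in every volume (Shen–Zhu–Zhu Cor. 1.5 / Rem. 4.6 shape; the venture `YMGap` has DLR /
  limit-point versions on other windows).

THEOREMS ONLY, no definition, no sorry.  HONEST FRAMING: STRONG coupling, fixed lattice, `SU(2)`, `d = 3`; no area law, nothing at weak coupling /
in the continuum, nothing `K`-uniform along the route's scaling (`UniformColdStartMixing`, 24809, ASIDE, not restated); no crux, rung or summit
statement is proved; the Yang–Mills mass gap is NOT proved.

References: H. Shen, R. Zhu, X. Zhu, CMP 400 (2023) 805–851 = arXiv:2204.12737, Cor. 4.4 (4.11), Cor. 1.5, Rem. 4.6 [ShenZhuZhu2022].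
-/

set_option autoImplicit false

noncomputable section

namespace Summit.QuantumFields.YangMills.Theorems.ColdStartUniversality

open MeasureTheory ProbabilityTheory Finset Filter Set Function
open scoped BigOperators NNReal ENNReal Topology Matrix Matrix.Norms.Frobenius ContDiff
open SimpleGraph
open Literature.Probability.LatticeModels (Site zdGraph Torus.proj Torus.proj_apply)
open Literature.Probability.Process Literature.MathematicalPhysics.QuantumFieldTheory
open Literature.MathematicalPhysics.QuantumLattice (fundamentalRep fundamentalLatticeRep continuous_fundamentalRep fundamentalRep_apply
  torusEdge torusLift LGConfig normalisedCharacter wilsonLoopObs rectWalk length_rectWalk)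
open Summit.Ventures.YMGap.RobustBall (dartMult)

/-! ## §1. Lipschitz cylinder observables on the torus -/

/-- **Variance of link-Lipschitz cylinder observables on the torus** under a frame-Hessian bound `K₀ < 2`: for `F = f((U_e)_(e∈Λ)) ∘ torusLift`
with `f` smooth and `ℓ_e`-Lipschitz in the link `e` (Frobenius distance) and `Λ` mapped injectively to `(ℤ/L)³`,
`∫ (F − ⟨F⟩)² dμ_{L,β'} ≤ Σ_e ℓ_e² / (1 − K₀/2)` (gradient-form Poincaré inequality and `|∇_e F|² ≤ ℓ_e²`). [cite: ShenZhuZhu2022, Corollary 4.4 (4.11)] -/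
theorem torus_cylinder_variance_le_of_hessBound (L : ℕ) [NeZero L] (β' K₀ : ℝ) (hK : K₀ < 2)
    (hHess : (∀ (V : (GaugeConfig 3 L (Matrix.specialUnitaryGroup (Fin 2) ℂ))) (Λ : (Edge 3 L × Fin (fundamentalLatticeRep 2).N × Fin (fundamentalLatticeRep 2).N × Bool → ℝ) →L[ℝ] ℝ),
      ∑ n : Edge 3 L × NoiseIdx (fundamentalLatticeRep 2).N, ∑ m : Edge 3 L × NoiseIdx (fundamentalLatticeRep 2).N,
        Λ ((fun q : Edge 3 L × Fin (fundamentalLatticeRep 2).N × Fin (fundamentalLatticeRep 2).N × Bool => if n.1 = q.1 then (fun z : ℂ => if q.2.2.2 then z.im else z.re) (((Real.sqrt 2 : ℂ) • ((fundamentalLatticeRep 2).lieProj (noiseDir n.2) * (fun (ee : Edge 3 L) => Matrix.of fun (i j : Fin (fundamentalLatticeRep 2).N) => (((fun (V : GaugeConfig 3 L (Matrix.specialUnitaryGroup (Fin 2) ℂ)) (q : Edge 3 L × Fin (fundamentalLatticeRep 2).N × Fin (fundamentalLatticeRep 2).N × Bool) => (fun z : ℂ => if q.2.2.2 then z.im else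 z.re) ((fundamentalRep (Fin 2) (V q.1) : Matrix (Fin 2) (Fin 2) ℂ) q.2.1 q.2.2.1)) V (ee, i, j, false) : ℝ) : ℂ) + (((fun (V : GaugeConfig 3 L (Matrix.specialUnitaryGroup (Fin 2) ℂ)) (q : Edge 3 L × Fin (fundamentalLatticeRep 2).N × Fin (fundamentalLatticeRep 2).N × Bool) => (fun z : ℂ => if q.2.2.2 then z.im else z.re) ((fundamentalRep (Fin 2) (V q.1) : Matrix (Fin 2) (Fin 2) ℂ) q.2.1 q.2.2.1)) V (ee, i, j, true) : ℝ) : ℂ) * Complex.I) q.1)) q.2.1 q.2.2.1) else 0)) * Λ ((fun q : Edge 3 L × Fin (fundamentalLatticeRep 2).N × Fin (fundamentalLatticeRep 2).N × Bool => if m.1 = q.1 then (fun z : ℂ => if q.2.2.2 then z.im else z.re) (((Real.sqrt 2 : ℂ) • ((fundamentalLatticeRep 2).lieProj (noiseDir m.2) * (fun (ee : Edge 3 L) => Matrix.of fun (i j : Fin (fundamentalLatticeRep 2).N) => (((fun (V : GaugeConfig 3 L (Matrix.specialUnitaryGroup (Fin 2) ℂ)) (q : Edge 3 L × Fin (fundamentalLatticeRep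 2).N × Fin (fundamentalLatticeRep 2).N × Bool) => (fun z : ℂ => if q.2.2.2 then z.im else z.re) ((fundamentalRep (Fin 2) (V q.1) : Matrix (Fin 2) (Fin 2) ℂ) q.2.1 q.2.2.1)) V (ee, i, j, false) : ℝ) : ℂ) + (((fun (V : GaugeConfig 3 L (Matrix.specialUnitaryGroup (Fin 2) ℂ)) (q : Edge 3 L × Fin (fundamentalLatticeRep 2).N × Fin (fundamentalLatticeRep 2).N × Bool) => (fun z : ℂ => if q.2.2.2 then z.im else z.re) ((fundamentalRep (Fin 2) (V q.1) : Matrix (Fin 2) (Fin 2) ℂ) q.2.1 q.2.2.1)) V (ee, i, j, true) : ℝ) : ℂ) * Complex.I) q.1)) q.2.1 q.2.2.1) else 0)) *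
          fderiv ℝ (fun z : (Edge 3 L × Fin (fundamentalLatticeRep 2).N × Fin (fundamentalLatticeRep 2).N × Bool → ℝ) => fderiv ℝ (fun y : (Edge 3 L × Fin (fundamentalLatticeRep 2).N × Fin (fundamentalLatticeRep 2).N × Bool → ℝ) => β' * ∑ p : Plaquette 3 L, (rootedLoop (fun (ee : Edge 3 L) (i j : Fin (fundamentalLatticeRep 2).N) => ((y (ee, i, j, false) : ℝ) : ℂ) + ((y (ee, i, j, true) : ℝ) : ℂ) * Complex.I) (p.1, p.2.1.1) p.2.1.2 false).trace.re) z (fun q : Edge 3 L × Fin (fundamentalLatticeRep 2).N × Fin (fundamentalLatticeRep 2).N × Bool => if m.1 = q.1 then (fun z : ℂ => if q.2.2.2 then z.im else z.re) (((Real.sqrt 2 : ℂ) • ((fundamentalLatticeRep 2).lieProj (noiseDir m.2) * (fun (ee : Edge 3 L) => Matrix.of fun (i j : Fin (fundamentalLatticeRep 2).N) => ((z (ee, i, j, false) : ℝ) : ℂ) + ((z (ee, i, j, true) : ℝ) : ℂ) * Complex.I) q.1)) q.2.1 q.2.2.1) else 0)) ((fun (V : GaugeConfig 3 L (Matrix.specialUnitaryGroup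 (Fin 2) ℂ)) (q : Edge 3 L × Fin (fundamentalLatticeRep 2).N × Fin (fundamentalLatticeRep 2).N × Bool) => (fun z : ℂ => if q.2.2.2 then z.im else z.re) ((fundamentalRep (Fin 2) (V q.1) : Matrix (Fin 2) (Fin 2) ℂ) q.2.1 q.2.2.1)) V) (fun q : Edge 3 L × Fin (fundamentalLatticeRep 2).N × Fin (fundamentalLatticeRep 2).N × Bool => if n.1 = q.1 then (fun z : ℂ => if q.2.2.2 then z.im else z.re) (((Real.sqrt 2 : ℂ) • ((fundamentalLatticeRep 2).lieProj (noiseDir n.2) * (fun (ee : Edge 3 L) => Matrix.of fun (i j : Fin (fundamentalLatticeRep 2).N) => (((fun (V : GaugeConfig 3 L (Matrix.specialUnitaryGroup (Fin 2) ℂ)) (q : Edge 3 L × Fin (fundamentalLatticeRep 2).N × Fin (fundamentalLatticeRep 2).N × Bool) => (fun z : ℂ => if q.2.2.2 then z.im else z.re) ((fundamentalRep (Fin 2) (V q.1) : Matrix (Fin 2) (Fin 2) ℂ) q.2.1 q.2.2.1)) V (ee, i, j, false) : ℝ) : ℂ) + (((fun (V : GaugeConfig 3 L (Matrix.specialUnitaryGroup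 (Fin 2) ℂ)) (q : Edge 3 L × Fin (fundamentalLatticeRep 2).N × Fin (fundamentalLatticeRep 2).N × Bool) => (fun z : ℂ => if q.2.2.2 then z.im else z.re) ((fundamentalRep (Fin 2) (V q.1) : Matrix (Fin 2) (Fin 2) ℂ) q.2.1 q.2.2.1)) V (ee, i, j, true) : ℝ) : ℂ) * Complex.I) q.1)) q.2.1 q.2.2.1) else 0)
        ≤ K₀ * ∑ n : Edge 3 L × NoiseIdx (fundamentalLatticeRep 2).N, (Λ (fun q : Edge 3 L × Fin (fundamentalLatticeRep 2).N × Fin (fundamentalLatticeRep 2).N × Bool => if n.1 = q.1 then (fun z : ℂ => if q.2.2.2 then z.im else z.re) (((Real.sqrt 2 : ℂ) • ((fundamentalLatticeRep 2).lieProj (noiseDir n.2) * (fun (ee : Edge 3 L) => Matrix.of fun (i j : Fin (fundamentalLatticeRep 2).N) => (((fun (V : GaugeConfig 3 L (Matrix.specialUnitaryGroup (Fin 2) ℂ)) (q : Edge 3 L × Fin (fundamentalLatticeRep 2).N × Fin (fundamentalLatticeRep 2).N × Bool) => (fun z : ℂ => if q.2.2.2 then z.im else z.re) ((fundamentalRep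 (Fin 2) (V q.1) : Matrix (Fin 2) (Fin 2) ℂ) q.2.1 q.2.2.1)) V (ee, i, j, false) : ℝ) : ℂ) + (((fun (V : GaugeConfig 3 L (Matrix.specialUnitaryGroup (Fin 2) ℂ)) (q : Edge 3 L × Fin (fundamentalLatticeRep 2).N × Fin (fundamentalLatticeRep 2).N × Bool) => (fun z : ℂ => if q.2.2.2 then z.im else z.re) ((fundamentalRep (Fin 2) (V q.1) : Matrix (Fin 2) (Fin 2) ℂ) q.2.1 q.2.2.1)) V (ee, i, j, true) : ℝ) : ℂ) * Complex.I) q.1)) q.2.1 q.2.2.1) else 0)) ^ 2))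
    (Λ : Finset (Literature.MathematicalPhysics.QuantumLattice.ZdEdge 3)) (hinj : Set.InjOn (torusEdge (d := 3) L) ↑Λ)
    (f : (↥Λ → Matrix (Fin 2) (Fin 2) ℂ) → ℝ) (hf : ContDiff ℝ ∞ f) (ℓ : ↥Λ → ℝ) (hℓ : ∀ e, 0 ≤ ℓ e)
    (hLip : ∀ (e : ↥Λ) (M M' : ↥Λ → Matrix.specialUnitaryGroup (Fin 2) ℂ), (∀ e', e' ≠ e → M e' = M' e') →
      |f (fun e' => (M e' : Matrix (Fin 2) (Fin 2) ℂ)) - f (fun e' => (M' e' : Matrix (Fin 2) (Fin 2) ℂ))| ≤ ℓ e * suFrobDist (M e) (M' e)) :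
    ∫ V, (matrixCylinder Λ f (torusLift L V) - ∫ V', matrixCylinder Λ f (torusLift L V') ∂(wilsonMeasure (d := 3) (L := L) (fundamentalRep (Fin 2)) β')) ^ 2 ∂(wilsonMeasure (d := 3) (L := L) (fundamentalRep (Fin 2)) β') ≤
      (∑ e, ℓ e ^ 2) / (1 - K₀ / 2) := by
  classical
  set μ' : Measure (GaugeConfig 3 L (Matrix.specialUnitaryGroup (Fin 2) ℂ)) := (wilsonMeasure (d := 3) (L := L) (fundamentalRep (Fin 2)) β') with hμ'
  haveI : IsProbabilityMeasure μ' :=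
    isProbabilityMeasure_wilsonMeasure (d := 3) (L := L) (fundamentalRep (Fin 2)) (continuous_fundamentalRep (Fin 2)) β'
  have hK1 : 0 < 1 - K₀ / 2 := by linarith
  have h := torus_variance_le_sum_linkGradSq_of_hessBound L β' K₀ hK hHess Λ hinj f hf
  have hfd : Differentiable ℝ f := hf.differentiable (by simp)
  have hN : (2 : ℕ) ≠ 0 := by norm_num
  have hres : Continuous fun V : (GaugeConfig 3 L (Matrix.specialUnitaryGroup (Fin 2) ℂ)) =>
      (fun e' : ↥Λ => ((torusLift L V e'.1 : Matrix.specialUnitaryGroup (Fin 2) ℂ) : Matrix (Fin 2) (Fin 2) ℂ)) :=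
    continuous_pi fun e => continuous_subtype_val.comp (continuous_apply _)
  have hsum : ∑ e : ↥Λ, ∫ V, linkGradSq Λ f e
        (fun e' : ↥Λ => ((torusLift L V e'.1 : Matrix.specialUnitaryGroup (Fin 2) ℂ) : Matrix (Fin 2) (Fin 2) ℂ)) ∂μ' ≤
      ∑ e : ↥Λ, ℓ e ^ 2 := by
    refine Finset.sum_le_sum fun e _ => ?_
    have hgc : Continuous fun V : (GaugeConfig 3 L (Matrix.specialUnitaryGroup (Fin 2) ℂ)) =>
        linkGradSq Λ f e (fun e' : ↥Λ => ((torusLift L V e'.1 : Matrix.specialUnitaryGroup (Fin 2) ℂ) : Matrix (Fin 2) (Fin 2) ℂ)) :=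
      (continuous_linkGradSq Λ hf e).comp hres
    calc ∫ V, linkGradSq Λ f e (fun e' : ↥Λ => ((torusLift L V e'.1 : Matrix.specialUnitaryGroup (Fin 2) ℂ) : Matrix (Fin 2) (Fin 2) ℂ)) ∂μ'
        ≤ ∫ V, ℓ e ^ 2 ∂μ' :=
          integral_mono (integrable_of_continuous_of_compactSpace hgc _) (integrable_const _) fun V =>
            linkGradSq_le_sq_of_linkLipschitz hN Λ hfd e (hℓ e) (hLip e) (fun e' : ↥Λ => torusLift L V e'.1)
      _ = ℓ e ^ 2 := by simp
  exact h.trans (div_le_div_of_nonneg_right hsum hK1.le)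

/-- ★★ **Volume-uniform variance bound for link-Lipschitz cylinder observables, `|β'| < 1/12`**: for EVERY torus size `L`,
`∫ (F − ⟨F⟩)² dμ_{L,β'} ≤ Σ_e ℓ_e² / (1 − 12|β'|)` (`K₀ = 24|β'|`, `wilson_hessBound`).  The Yang–Mills mass gap is NOT proved.
[cite: ShenZhuZhu2022, Corollary 4.4 (4.11), Theorem 1.4] -/
theorem torus_cylinder_variance_su2_uniform {β' : ℝ} (hβ : |β'| < 1 / 12) (L : ℕ) [NeZero L]
    (Λ : Finset (Literature.MathematicalPhysics.QuantumLattice.ZdEdge 3)) (hinj : Set.InjOn (torusEdge (d := 3) L) ↑Λ)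
    (f : (↥Λ → Matrix (Fin 2) (Fin 2) ℂ) → ℝ) (hf : ContDiff ℝ ∞ f) (ℓ : ↥Λ → ℝ) (hℓ : ∀ e, 0 ≤ ℓ e)
    (hLip : ∀ (e : ↥Λ) (M M' : ↥Λ → Matrix.specialUnitaryGroup (Fin 2) ℂ), (∀ e', e' ≠ e → M e' = M' e') →
      |f (fun e' => (M e' : Matrix (Fin 2) (Fin 2) ℂ)) - f (fun e' => (M' e' : Matrix (Fin 2) (Fin 2) ℂ))| ≤ ℓ e * suFrobDist (M e) (M' e)) :
    ∫ V, (matrixCylinder Λ f (torusLift L V) - ∫ V', matrixCylinder Λ f (torusLift L V') ∂(wilsonMeasure (d := 3) (L := L) (fundamentalRep (Fin 2)) β')) ^ 2 ∂(wilsonMeasure (d := 3) (L := L) (fundamentalRep (Fin 2)) β') ≤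
      (∑ e, ℓ e ^ 2) / (1 - 12 * |β'|) := by
  have hK : 24 * |β'| < 2 := by linarith
  have h := torus_cylinder_variance_le_of_hessBound L β' (24 * |β'|) hK (wilson_hessBound L β') Λ hinj f hf ℓ hℓ hLip
  have e : 1 - 24 * |β'| / 2 = 1 - 12 * |β'| := by ring
  rw [e] at h
  exact h

/-! ## §2. Wilson loops on the torus -/

/-- ★★ **Variance of Wilson loops on every torus, uniformly in the volume, `|β'| < 1/12`**: for every closed lattice walk `C` whose links stay
distinct on `(ℤ/L)³`, `∫ (W_C∘lift − ⟨W_C∘lift⟩)² dμ_{L,β'} ≤ Σ_{e ∈ links(C)} mult_C(e)² / (2(1 − 12|β'|))`, `W_C = ½ Re tr hol_C`.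
The Yang–Mills mass gap is NOT proved. [cite: ShenZhuZhu2022, Corollary 1.5, Remark 4.6] -/
theorem torus_wilsonLoop_variance_su2_uniform {β' : ℝ} (hβ : |β'| < 1 / 12) (L : ℕ) [NeZero L]
    {x : Site 3} (w : (zdGraph 3).Walk x x) (hinj : Set.InjOn (torusEdge (d := 3) L) ↑(walkEdges w)) :
    ∫ V, (wilsonLoopObs (fun g : Matrix.specialUnitaryGroup (Fin 2) ℂ => normalisedCharacter 2 (fundamentalRep (Fin 2) g)) w (torusLift L V) -
        ∫ V', wilsonLoopObs (fun g : Matrix.specialUnitaryGroup (Fin 2) ℂ => normalisedCharacter 2 (fundamentalRep (Fin 2) g)) w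
          (torusLift L V') ∂(wilsonMeasure (d := 3) (L := L) (fundamentalRep (Fin 2)) β')) ^ 2 ∂(wilsonMeasure (d := 3) (L := L) (fundamentalRep (Fin 2)) β') ≤
      (∑ e ∈ walkEdges w, (dartMult w e : ℝ) ^ 2) / (2 * (1 - 12 * |β'|)) := by
  classical
  obtain ⟨f, hf, hrep, hLip⟩ := exists_smooth_linkLipschitz_wilsonLoopObs (N := 2) w
  set ℓ : ↥(walkEdges w) → ℝ := fun e =>
    (dartMult w (e : Literature.MathematicalPhysics.QuantumLattice.ZdEdge 3) : ℝ) / Real.sqrt ((2 : ℕ) : ℝ) with hℓdef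
  have hℓ : ∀ e, 0 ≤ ℓ e := fun e => div_nonneg (Nat.cast_nonneg _) (Real.sqrt_nonneg _)
  have hsum : ∑ e, ℓ e ^ 2 = (∑ e ∈ walkEdges w, (dartMult w e : ℝ) ^ 2) / 2 := by
    have h2 : Real.sqrt ((2 : ℕ) : ℝ) ^ 2 = 2 := by rw [Real.sq_sqrt (Nat.cast_nonneg _)]; norm_num
    simp only [hℓdef, div_pow, h2]
    rw [← Finset.sum_div, Finset.sum_coe_sort (walkEdges w) (fun e => (dartMult w e : ℝ) ^ 2)]
  have h := torus_cylinder_variance_su2_uniform hβ L (walkEdges w) hinj f hf ℓ hℓ hLip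
  have hF : ∀ V : (GaugeConfig 3 L (Matrix.specialUnitaryGroup (Fin 2) ℂ)), matrixCylinder (walkEdges w) f (torusLift L V) =
      wilsonLoopObs (fun g : Matrix.specialUnitaryGroup (Fin 2) ℂ => normalisedCharacter 2 (fundamentalRep (Fin 2) g)) w (torusLift L V) :=
    fun V => hrep _
  simp_rw [hF] at h
  rw [hsum, div_div] at h
  exact h

/-- ★★ **Perimeter growth of Wilson-loop fluctuations on every torus, closed trails**: `∫ (W_C∘lift − ⟨W_C∘lift⟩)² dμ_{L,β'} ≤ |C| / (2(1 − 12|β'|))`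
for every closed trail `C` (no link twice) whose links stay distinct on `(ℤ/L)³`, `|β'| < 1/12`, every `L`.  The Yang–Mills mass gap is NOT proved.
[cite: ShenZhuZhu2022, Corollary 1.5, Remark 4.6] -/
theorem torus_wilsonLoop_variance_su2_uniform_of_isTrail {β' : ℝ} (hβ : |β'| < 1 / 12) (L : ℕ) [NeZero L]
    {x : Site 3} {w : (zdGraph 3).Walk x x} (htr : w.IsTrail) (hinj : Set.InjOn (torusEdge (d := 3) L) ↑(walkEdges w)) :
    ∫ V, (wilsonLoopObs (fun g : Matrix.specialUnitaryGroup (Fin 2) ℂ => normalisedCharacter 2 (fundamentalRep (Fin 2) g)) w (torusLift L V) -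
        ∫ V', wilsonLoopObs (fun g : Matrix.specialUnitaryGroup (Fin 2) ℂ => normalisedCharacter 2 (fundamentalRep (Fin 2) g)) w
          (torusLift L V') ∂(wilsonMeasure (d := 3) (L := L) (fundamentalRep (Fin 2)) β')) ^ 2 ∂(wilsonMeasure (d := 3) (L := L) (fundamentalRep (Fin 2)) β') ≤
      (w.length : ℝ) / (2 * (1 - 12 * |β'|)) := by
  have h := torus_wilsonLoop_variance_su2_uniform hβ L w hinj
  rw [sum_dartMult_sq_eq_length_of_isTrail htr] at h
  exact h

/-! ## §3. Rectangles, in the tree's finite-volume vocabulary -/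

/-- ★★★ **Variance of rectangular Wilson loops on every torus grows at most with the perimeter.**  For the periodic `SU(2)` Wilson measure
`wilsonMeasure (fundamentalRep (Fin 2)) β'` on `(ℤ/L)³` at tree coupling `|β'| < 1/12`, every torus base point `x`, every coordinate plane `i ≠ j`
and all `1 ≤ R < L`, `1 ≤ T < L`:  `Var[wilsonLoop (fundamentalRep (Fin 2)) x i j R T] ≤ (R + T)/(1 − 12|β'|)` — the same bound in every volume
(Shen–Zhu–Zhu Cor. 1.5 / Rem. 4.6 shape).  Strong coupling, fixed lattice; the Yang–Mills mass gap is NOT proved.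
[cite: ShenZhuZhu2022, Corollary 1.5, Remark 4.6] -/
theorem torus_wilsonLoop_rect_variance_su2 {β' : ℝ} (hβ : |β'| < 1 / 12) (L : ℕ) [NeZero L]
    (x : Literature.MathematicalPhysics.QuantumFieldTheory.Site 3 L) {i j : Fin 3} (hij : i ≠ j) {R T : ℕ}
    (hR : 1 ≤ R) (hT : 1 ≤ T) (hRL : R < L) (hTL : T < L) :
    Var[wilsonLoop (fundamentalRep (Fin 2)) x i j R T; (wilsonMeasure (d := 3) (L := L) (fundamentalRep (Fin 2)) β')] ≤ ((R : ℝ) + T) / (1 - 12 * |β'|) := by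
  classical
  set μ' : Measure (GaugeConfig 3 L (Matrix.specialUnitaryGroup (Fin 2) ℂ)) := (wilsonMeasure (d := 3) (L := L) (fundamentalRep (Fin 2)) β') with hμ'
  haveI : IsProbabilityMeasure μ' :=
    isProbabilityMeasure_wilsonMeasure (d := 3) (L := L) (fundamentalRep (Fin 2)) (continuous_fundamentalRep (Fin 2)) β'
  -- lift the base point to `ℤ³`
  set x₀ : Site 3 := fun k => ((x k).val : ℤ) with hx₀
  have hx : Torus.proj L x₀ = x := by
    funext k
    rw [Torus.proj_apply, hx₀]
    simp only [Int.cast_natCast, ZMod.natCast_zmod_val]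
  have hW : ∀ V : (GaugeConfig 3 L (Matrix.specialUnitaryGroup (Fin 2) ℂ)),
      wilsonLoopObs (fun g : Matrix.specialUnitaryGroup (Fin 2) ℂ => normalisedCharacter 2 (fundamentalRep (Fin 2) g))
          (rectWalk x₀ i j R T) (torusLift L V) =
        wilsonLoop (fundamentalRep (Fin 2)) x i j R T V := by
    intro V; rw [wilsonLoopObs_rectWalk_torusLift, hx]
  -- continuity (hence measurability) of the torus Wilson loop, through the smooth-cylinder representation
  obtain ⟨f, hf, hrep, -⟩ := exists_smooth_linkLipschitz_wilsonLoopObs (N := 2) (rectWalk x₀ i j R T)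
  have hres : Continuous fun V : (GaugeConfig 3 L (Matrix.specialUnitaryGroup (Fin 2) ℂ)) =>
      (fun e' : ↥(walkEdges (rectWalk x₀ i j R T)) =>
        ((torusLift L V e'.1 : Matrix.specialUnitaryGroup (Fin 2) ℂ) : Matrix (Fin 2) (Fin 2) ℂ)) :=
    continuous_pi fun e => continuous_subtype_val.comp (continuous_apply _)
  have hWf : wilsonLoop (fundamentalRep (Fin 2)) x i j R T = fun V : (GaugeConfig 3 L (Matrix.specialUnitaryGroup (Fin 2) ℂ)) =>
      matrixCylinder (walkEdges (rectWalk x₀ i j R T)) f (torusLift L V) := by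
    funext V; rw [hrep, hW]
  have hWc : Continuous (wilsonLoop (fundamentalRep (Fin 2)) x i j R T : (GaugeConfig 3 L (Matrix.specialUnitaryGroup (Fin 2) ℂ)) → ℝ) := by
    rw [hWf]; exact hf.continuous.comp hres
  have hWm : AEMeasurable (wilsonLoop (fundamentalRep (Fin 2)) x i j R T : (GaugeConfig 3 L (Matrix.specialUnitaryGroup (Fin 2) ℂ)) → ℝ) μ' := hWc.measurable.aemeasurable
  rw [variance_eq_integral hWm]
  have h := torus_wilsonLoop_variance_su2_uniform hβ L (rectWalk x₀ i j R T) (injOn_torusEdge_walkEdges_rectWalk L x₀ hij hRL hTL)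
  simp_rw [hW] at h
  rw [sum_dartMult_sq_rectWalk x₀ hij hR hT] at h
  calc ∫ V, (wilsonLoop (fundamentalRep (Fin 2)) x i j R T V - ∫ V', wilsonLoop (fundamentalRep (Fin 2)) x i j R T V' ∂μ') ^ 2 ∂μ'
      ≤ 2 * ((R : ℝ) + T) / (2 * (1 - 12 * |β'|)) := h
    _ = ((R : ℝ) + T) / (1 - 12 * |β'|) := by rw [mul_div_mul_left _ _ (two_ne_zero)]

end Summit.QuantumFields.YangMills.Theorems.ColdStartUniversality

end
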